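import Literature.Barriers.PneNP.MatchingPolytopeExtensionComplexity
import HarnessLib

/-!
# `P_M(K_n)` is a coordinate projection of `P_PM(K_{2n})`: `xc(P_M(n)) ≤ xc(P_PM(2n))`
# (Rothvoß 2017, §1, footnote), also for psd lifts

T. Rothvoß, *The matching polytope has exponential extension complexity*, J. ACM 64 (2017) =
arXiv:1311.2369 [Rothvoss2017], §1 (PDF p. 4, L41–42), verbatim:

> "But one can also prove that `xc(P_M(n)) ≤ xc(P_PM(2n))` [Footnote: Simply take a complete graph
> `G = (V,E)` on `2n` nodes and a subset `U ⊆ V` of `|U| = n` nodes. Then if we take all perfect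
> matchings `M` in `G`, then `M ∩ E(U)` gives all matchings in `U`. This construction implies that
> `P_M(n)` is a face of `P_PM(2n)`.]"

(what the construction gives, precisely, is that `P_M(n)` is the coordinate PROJECTION of `P_PM(2n)`
onto the edges inside `U` — which suffices for `xc(P_M(n)) ≤ xc(P_PM(2n))`, projections being free).
Companion of `MatchingPolytopeExtensionComplexity.lean` (the other direction,
`xc(P_PM(n)) ≤ xc(P_M(n))`, "`P_PM` is a face of `P_M`").  This file PROVES (no named facts):

* `extend_matching` — the footnote's combinatorial content: every matching of the first `n`
  vertices of `K_{2n}` (a `0/1` point of Edmonds' `P(H)`, `H` = the copy of `K_n` on the first `n`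
  vertices) is `M ∩ E(U)` for some PERFECT matching `M` of `K_{2n}` (match the uncovered vertices of
  `U` to their mirror images, and the rest of the second block among themselves);
* `image_restrict_pmPolytope` — `π_{E(U)}(P_PM(K_{2n})) = P_M(H)` (`⊆`: a point of `P_PM ⊆ P_M(K_{2n})`
  restricts to `P_M(H)`, `restrictEdges_mem_edmondsPolytope`; `⊇`: Edmonds' theorem
  `P_M(H) = conv P(H)` and linearity of the projection);
* **`hasEFOfSize_edmondsPolytope_of_pmPolytope_two_mul`** — `xc(P_M(K_n)) ≤ xc(P_PM(K_{2n}))`: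
  an extended formulation of `P_PM(K_{2n})` of size `r` yields one of `P_M(K_n)` of size `r`
  (projection `HasEFOfSize.image_linearMap`, then the vertex-embedding transport
  `hasEFOfSize_edmondsPolytope_map_iff`); and the SEMIDEFINITE twin
  **`hasPsdLift_edmondsPolytope_of_pmPolytope_two_mul`** (`HasPsdLift.image`,
  `hasPsdLift_edmondsPolytope_map_iff`).

Together with the face direction this makes the LP and SDP extension complexities of the matching
and perfect matching polytopes of complete graphs polynomially equivalent in the kernel:
`xc(P_PM(K_n)) ≤ xc(P_M(K_n)) ≤ xc(P_PM(K_{2n}))`, and the same for psd lifts — so the printed open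
question "whether matching polytopes also have high semidefinite extension complexity" (Fawzi–Gouveia–
Parrilo–Saunderson–Thomas [FawziEtAl2020], §6 Discussion, arXiv:2002.09788 p0030 L47–48) has the same
answer for either family.

WHAT THIS IS NOT: no lower or upper bound on any extension complexity is proved here beyond these
comparisons; nothing on P versus NP.

## References

* [FawziEtAl2020] H. Fawzi, J. Gouveia, P. A. Parrilo, J. Saunderson, R. R. Thomas, *Lifting for
  simplicity: concise descriptions of convex sets*, SIAM Review 64 (2022) 866–918, arXiv:2002.09788 — §6
  Discussion (p0030 L47–48: the open question on the semidefinite extension complexity of matchings).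
* [Rothvoss2017] T. Rothvoß, *The matching polytope has exponential extension complexity*, J. ACM 64
  (2017) Art. 41, doi:10.1145/3127497, arXiv:1311.2369 — §1 (PDF p. 4, L41–42 with its footnote).
* [Edmonds1965] J. Edmonds, *Maximum matching and a polyhedron with 0,1-vertices*, J. Res. Nat. Bur.
  Standards 69B (1965) 125–130 — §2 Thm. (P) (tree: `EdmondsMatchingPolytope.lean`).
-/

noncomputable section

open Finset Matrix

namespace Literature.Barriers.PneNP

open Literature.Combinatorics.Optimization Literature.Combinatorics.Optimization.StephenTuncel1999

variable {n : ℕ}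

/-! ### The copy of `K_n` on the first `n` vertices of `K_{2n}` -/

/-- The copy `H` of `K_n` on the first `n` vertices `U = {0, …, n−1}` of `K_{2n}` (the other `n`
vertices isolated): `H = K_n.map (i ↦ i)`; throughout, `2n` is spelled `n + n` (the index arithmetic of
`Fin.castAdd` / `Fin.natAdd`). [cite: Rothvoss2017, §1 footnote (PDF p. 4)] -/
abbrev halfGraph (n : ℕ) : SimpleGraph (Fin (n + n)) :=
  (⊤ : SimpleGraph (Fin n)).map (Fin.castAddEmb n)

/-- Edges of `H` join two vertices of the first block. [cite: Rothvoss2017, §1 footnote (PDF p. 4)] -/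
theorem lt_of_mem_halfGraph_edgeSet {e : Sym2 (Fin (n + n))} (he : e ∈ (halfGraph n).edgeSet)
    {v : Fin (n + n)} (hv : v ∈ e) : (v : ℕ) < n := by
  induction e using Sym2.ind with
  | h a b =>
    have hadj : (halfGraph n).Adj a b := he
    rw [halfGraph, SimpleGraph.map_adj] at hadj
    obtain ⟨a', b', -, rfl, rfl⟩ := hadj
    rcases Sym2.mem_iff.1 hv with rfl | rfl
    · rw [Fin.castAddEmb_apply, Fin.val_castAdd]; exact a'.2
    · rw [Fin.castAddEmb_apply, Fin.val_castAdd]; exact b'.2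

/-- `H ≤ K_{2n}` ("a subset `U ⊆ V`" of the vertices of the complete graph on `2n` nodes).
[cite: Rothvoss2017, §1 footnote (PDF p. 4)] -/
theorem halfGraph_le : halfGraph n ≤ (⊤ : SimpleGraph (Fin (n + n))) :=
  le_top

/-! ### The footnote: every matching of `U` is `M ∩ E(U)` for a perfect matching `M` of `K_{2n}` -/

/-- The mirror vertex `n + i` of the first-block vertex `i`. [cite: Rothvoss2017, §1 footnote (PDF p. 4)] -/
private def mirror (i : Fin n) : Fin (n + n) := Fin.natAdd n i

/-- The first-block vertex `i`. [cite: Rothvoss2017, §1 footnote (PDF p. 4)] -/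
private def orig (i : Fin n) : Fin (n + n) := Fin.castAdd n i

/-- The value of the first-block vertex `i` is `i`. [folklore] -/
private theorem coe_orig (i : Fin n) : (orig i : ℕ) = i := Fin.val_castAdd n i

/-- The value of the mirror vertex of `i` is `n + i`. [folklore] -/
private theorem coe_mirror (i : Fin n) : (mirror i : ℕ) = n + i := Fin.val_natAdd n i

/-- `orig` is injective. [folklore] -/
private theorem orig_injective : Function.Injective (orig (n := n)) :=
  fun i j h => Fin.ext (by have := congrArg Fin.val h; rwa [coe_orig, coe_orig] at this)

/-- `mirror` is injective. [folklore] -/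
private theorem mirror_injective : Function.Injective (mirror (n := n)) :=
  fun i j h => Fin.ext (by have := congrArg Fin.val h; rw [coe_mirror, coe_mirror] at this; omega)

/-- The two blocks are disjoint. [folklore] -/
private theorem orig_ne_mirror (i j : Fin n) : orig i ≠ mirror j := by
  intro h
  have := congrArg Fin.val h
  rw [coe_orig, coe_mirror] at this
  have := i.2
  omega

/-- A vertex of `K_{2n}` with value `< n` is `orig i`. [folklore] -/
private theorem exists_orig_of_lt {v : Fin (n + n)} (hv : (v : ℕ) < n) : ∃ i, orig i = v :=
  ⟨⟨v, hv⟩, Fin.ext (by rw [coe_orig])⟩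

/-- A vertex of `K_{2n}` with value `≥ n` is `mirror i`. [folklore] -/
private theorem exists_mirror_of_le {v : Fin (n + n)} (hv : n ≤ (v : ℕ)) : ∃ i, mirror i = v :=
  ⟨⟨v - n, by have := v.2; omega⟩, Fin.ext (by rw [coe_mirror]; simp only; omega)⟩

/-- The blocks `{orig i, mirror i}` are pairwise disjoint. [folklore] -/
private theorem pairBlocks_disjoint (i j : Fin n) (hij : i ≠ j) :
    Disjoint ({orig i, mirror i} : Finset (Fin (n + n))) {orig j, mirror j} := by
  rw [Finset.disjoint_left]
  intro v hv hv'
  simp only [Finset.mem_insert, Finset.mem_singleton] at hv hv'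
  rcases hv with rfl | rfl <;> rcases hv' with h | h
  · exact hij (orig_injective h)
  · exact orig_ne_mirror i j h
  · exact orig_ne_mirror j i h.symm
  · exact hij (mirror_injective h)

section Extend

variable [DecidableRel (halfGraph n).Adj]

/-- **The edge set of a `0/1` point of `P(H)`**: the edges of `H` on which `y = 1`, as pairs of
vertices of `K_{2n}`. [cite: Rothvoss2017, §1 footnote (PDF p. 4: "M ∩ E(U)")] -/
private def supportEdges (y : (halfGraph n).edgeSet → ℝ) : Finset (Sym2 (Fin (n + n))) :=
  (univ.filter fun e : (halfGraph n).edgeSet => y e = 1).map (Function.Embedding.subtype _)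

/-- Membership in the support edge set. [folklore] -/
private theorem mem_supportEdges_iff {y : (halfGraph n).edgeSet → ℝ} {e : Sym2 (Fin (n + n))} :
    e ∈ supportEdges y ↔ ∃ h : e ∈ (halfGraph n).edgeSet, y ⟨e, h⟩ = 1 := by
  unfold supportEdges
  rw [Finset.mem_map]
  constructor
  · rintro ⟨e', he', rfl⟩
    rw [Finset.mem_filter] at he'
    exact ⟨e'.2, he'.2⟩
  · rintro ⟨h, hy⟩
    exact ⟨⟨e, h⟩, Finset.mem_filter.2 ⟨Finset.mem_univ _, hy⟩, rfl⟩

/-- The vertices covered by the support edges. [cite: Rothvoss2017, §1 footnote (PDF p. 4)] -/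
private def covered (y : (halfGraph n).edgeSet → ℝ) : Finset (Fin (n + n)) :=
  univ.filter fun v => ∃ e ∈ supportEdges y, v ∈ e

/-- Covered vertices lie in the first block. [folklore] -/
private theorem lt_of_mem_covered {y : (halfGraph n).edgeSet → ℝ} {v : Fin (n + n)}
    (hv : v ∈ covered y) : (v : ℕ) < n := by
  unfold covered at hv
  rw [Finset.mem_filter] at hv
  obtain ⟨e, he, hve⟩ := hv.2
  obtain ⟨h, -⟩ := mem_supportEdges_iff.1 he
  exact lt_of_mem_halfGraph_edgeSet h hve

/-- **The support of a `0/1` point of `P(H)` is a perfect matching of the covered vertices** (at most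
one support edge at each vertex by the degree constraint, at least one by definition).
[cite: Edmonds1965, §2 (p. 126): "P = the vectors satisfying (I) and (2)"] -/
private theorem isPMOn_covered_supportEdges {y : (halfGraph n).edgeSet → ℝ}
    (hy : y ∈ matchingVectors (halfGraph n)) : IsPMOn (covered y) (supportEdges y) := by
  classical
  refine ⟨fun e he => Finset.mem_sym2_iff.2 fun v hv => ?_, fun e he => ?_, fun v hv => ?_⟩
  · unfold covered
    exact Finset.mem_filter.2 ⟨Finset.mem_univ _, e, he, hv⟩
  · obtain ⟨h, -⟩ := mem_supportEdges_iff.1 he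
    have h' : e ∈ (⊤ : SimpleGraph (Fin (n + n))).edgeSet :=
      SimpleGraph.edgeSet_subset_edgeSet.2 halfGraph_le h
    simpa [SimpleGraph.edgeSet_top] using h'
  · -- at least one edge
    unfold covered at hv
    obtain ⟨e, he, hve⟩ := (Finset.mem_filter.1 hv).2
    have hge : 1 ≤ ((supportEdges y).filter fun e => v ∈ e).card :=
      Finset.card_pos.2 ⟨e, Finset.mem_filter.2 ⟨he, hve⟩⟩
    -- at most one edge: the degree constraint of `P(H)` at `v`
    have hle : (((supportEdges y).filter fun e => v ∈ e).card : ℝ) ≤ 1 := by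
      have hcount : (((supportEdges y).filter fun e => v ∈ e).card : ℝ) =
          ∑ e ∈ univ.filter (fun e : (halfGraph n).edgeSet => v ∈ (e : Sym2 (Fin (n + n)))),
            (if y e = 1 then (1 : ℝ) else 0) := by
        rw [Finset.sum_filter, ← Finset.sum_filter_add_sum_filter_not univ (fun e => y e = 1)]
        have hz : ∑ e ∈ univ.filter (fun e : (halfGraph n).edgeSet => ¬ y e = 1),
            (if v ∈ (e : Sym2 (Fin (n + n))) then if y e = 1 then (1 : ℝ) else 0 else 0) = 0 :=
          Finset.sum_eq_zero fun e he => by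
            rw [Finset.mem_filter] at he
            simp [he.2]
        rw [hz, add_zero]
        have h1 : ∑ e ∈ univ.filter (fun e : (halfGraph n).edgeSet => y e = 1),
            (if v ∈ (e : Sym2 (Fin (n + n))) then if y e = 1 then (1 : ℝ) else 0 else 0) =
            ∑ e ∈ univ.filter (fun e : (halfGraph n).edgeSet => y e = 1),
              (if v ∈ (e : Sym2 (Fin (n + n))) then (1 : ℝ) else 0) :=
          Finset.sum_congr rfl fun e he => by
            rw [Finset.mem_filter] at he
            simp [he.2]
        rw [h1, ← Finset.sum_filter, Finset.sum_const, nsmul_eq_mul, mul_one]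
        congr 1
        unfold supportEdges
        rw [Finset.filter_map, Finset.card_map]
        rfl
      have hyle : ∀ e : (halfGraph n).edgeSet, (if y e = 1 then (1 : ℝ) else 0) ≤ y e :=
        fun e => by rcases hy.1 e with h | h <;> simp [h]
      rw [hcount]
      exact (Finset.sum_le_sum fun e _ => hyle e).trans (hy.2 v)
    have hle' : ((supportEdges y).filter fun e => v ∈ e).card ≤ 1 := by exact_mod_cast hle
    omega

/-- Twice the number of support edges is the number of covered vertices (so the latter is even).
[folklore] -/
private theorem two_mul_card_supportEdges {y : (halfGraph n).edgeSet → ℝ}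
    (hy : y ∈ matchingVectors (halfGraph n)) :
    2 * (supportEdges y).card = (covered y).card :=
  (isPMOn_covered_supportEdges hy).two_mul_card

/-- **Extension of a matching of `U` to a perfect matching of `K_{2n}`** ("if we take all perfect
matchings `M` in `G`, then `M ∩ E(U)` gives all matchings in `U`"): for a `0/1` point `y` of `P(H)`
there is a perfect matching `M` of `K_{2n}` whose edges inside the first block are exactly the support
of `y` — the uncovered first-block vertices `i` are matched to their mirrors `n + i`, and the remaining
(evenly many) mirror vertices among themselves. [cite: Rothvoss2017, §1 footnote (PDF p. 4)] -/
theorem extend_matching {y : (halfGraph n).edgeSet → ℝ} (hy : y ∈ matchingVectors (halfGraph n)) :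
    ∃ M : Finset (Sym2 (Fin (n + n))), IsPMOn univ M ∧
      ∀ e : (halfGraph n).edgeSet, ((e : Sym2 (Fin (n + n))) ∈ M ↔ y e = 1) := by
  classical
  have hPM₀ := isPMOn_covered_supportEdges hy
  -- uncovered first-block indices and their mirror pairs
  set s : Finset (Fin n) := univ.filter fun i => orig i ∉ covered y with hs
  set P : Fin n → Finset (Fin (n + n)) := fun i => {orig i, mirror i} with hP
  have hAB : IsPMOn (s.biUnion P) (s.biUnion fun i => {s(orig i, mirror i)}) :=
    isPMOn_biUnion P (fun i j hij => pairBlocks_disjoint i j hij) s _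
      fun i _ => IsPMOn.pair (orig_ne_mirror i i)
  -- the leftover mirror vertices
  set B : Finset (Fin (n + n)) := (univ.filter fun i : Fin n => orig i ∈ covered y).image mirror
    with hB
  have hBcard : B.card = (covered y).card := by
    rw [hB, Finset.card_image_of_injective _ mirror_injective]
    -- `i ↦ orig i` is a bijection from `{i | orig i covered}` onto `covered y`
    rw [← Finset.card_image_of_injective _ orig_injective]
    congr 1
    ext v
    simp only [Finset.mem_image, Finset.mem_filter, Finset.mem_univ, true_and]
    constructor
    · rintro ⟨i, hi, rfl⟩; exact hi
    · intro hv
      obtain ⟨i, rfl⟩ := exists_orig_of_lt (lt_of_mem_covered hv)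
      exact ⟨i, hv, rfl⟩
  have hBeven : Even B.card := by
    rw [hBcard, ← two_mul_card_supportEdges hy]
    exact even_two_mul _
  obtain ⟨MB, hMB⟩ := exists_isPMOn_of_even B.card B rfl hBeven
  -- disjointness of the three vertex sets
  have hd1 : Disjoint (covered y) (s.biUnion P) := by
    rw [Finset.disjoint_left]
    intro v hv hv'
    rw [Finset.mem_biUnion] at hv'
    obtain ⟨i, hi, hvi⟩ := hv'
    rw [hs, Finset.mem_filter] at hi
    simp only [hP, Finset.mem_insert, Finset.mem_singleton] at hvi
    rcases hvi with rfl | rfl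
    · exact hi.2 hv
    · have := lt_of_mem_covered hv
      rw [coe_mirror] at this
      omega
  have hd2 : Disjoint (covered y ∪ s.biUnion P) B := by
    rw [Finset.disjoint_left]
    intro v hv hvB
    rw [hB, Finset.mem_image] at hvB
    obtain ⟨i, hi, rfl⟩ := hvB
    rw [Finset.mem_filter] at hi
    rcases Finset.mem_union.1 hv with hv | hv
    · have := lt_of_mem_covered hv
      rw [coe_mirror] at this
      omega
    · rw [Finset.mem_biUnion] at hv
      obtain ⟨j, hj, hvj⟩ := hv
      rw [hs, Finset.mem_filter] at hj
      simp only [hP, Finset.mem_insert, Finset.mem_singleton] at hvj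
      rcases hvj with h | h
      · exact orig_ne_mirror j i h.symm
      · rw [mirror_injective h] at hi
        exact hj.2 hi.2
  -- the union covers everything
  have hcover : covered y ∪ s.biUnion P ∪ B = univ := by
    apply Finset.eq_univ_of_forall
    intro v
    by_cases hv : (v : ℕ) < n
    · obtain ⟨i, rfl⟩ := exists_orig_of_lt hv
      by_cases hc : orig i ∈ covered y
      · exact Finset.mem_union_left _ (Finset.mem_union_left _ hc)
      · refine Finset.mem_union_left _ (Finset.mem_union_right _ ?_)
        rw [Finset.mem_biUnion]
        exact ⟨i, by rw [hs, Finset.mem_filter]; exact ⟨Finset.mem_univ _, hc⟩,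
          by simp [hP]⟩
    · obtain ⟨i, rfl⟩ := exists_mirror_of_le (not_lt.1 hv)
      by_cases hc : orig i ∈ covered y
      · refine Finset.mem_union_right _ ?_
        rw [hB, Finset.mem_image]
        exact ⟨i, Finset.mem_filter.2 ⟨Finset.mem_univ _, hc⟩, rfl⟩
      · refine Finset.mem_union_left _ (Finset.mem_union_right _ ?_)
        rw [Finset.mem_biUnion]
        exact ⟨i, by rw [hs, Finset.mem_filter]; exact ⟨Finset.mem_univ _, hc⟩,
          by simp [hP]⟩
  have hPM := (hPM₀.union hAB hd1).union hMB hd2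
  rw [hcover] at hPM
  refine ⟨_, hPM, fun e => ?_⟩
  -- the edges inside the first block are exactly the support edges
  have hlt : ∀ v ∈ (e : Sym2 (Fin (n + n))), (v : ℕ) < n :=
    fun v hv => lt_of_mem_halfGraph_edgeSet e.2 hv
  constructor
  · intro he
    rcases Finset.mem_union.1 he with he | he
    · rcases Finset.mem_union.1 he with he | he
      · obtain ⟨h, h1⟩ := mem_supportEdges_iff.1 he
        exact h1
      · exfalso
        rw [Finset.mem_biUnion] at he
        obtain ⟨i, -, hi⟩ := he
        rw [Finset.mem_singleton] at hi
        have := hlt (mirror i) (by rw [hi]; exact Sym2.mem_mk_right _ _)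
        rw [coe_mirror] at this
        omega
    · exfalso
      obtain ⟨e', he'⟩ := e
      induction e' using Sym2.ind with
      | h a b =>
        have ha := hMB.mem_of_mem he (Sym2.mem_mk_left a b)
        rw [hB, Finset.mem_image] at ha
        obtain ⟨i, -, hia⟩ := ha
        have := hlt a (Sym2.mem_mk_left a b)
        rw [← hia, coe_mirror] at this
        omega
  · intro hye
    exact Finset.mem_union_left _ (Finset.mem_union_left _ (mem_supportEdges_iff.2 ⟨e.2, hye⟩))

end Extend

/-! ### The projection identity and its consequences -/

section Projection

variable [DecidableRel (halfGraph n).Adj]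

/-- **`π_{E(U)}(P_PM(K_{2n})) = P_M(H)`**: the coordinate projection of the perfect matching polytope
of `K_{2n}` onto the edges inside the first block is the matching polytope of the copy `H` of `K_n`
there.  `⊆`: `P_PM(K_{2n}) ⊆ P_M(K_{2n})` (the face relation) and restriction to a subgraph
(`restrictEdges_mem_edmondsPolytope`); `⊇`: Edmonds' theorem `P_M(H) = conv P(H)`, linearity of the
projection, and `extend_matching`. [cite: Rothvoss2017, §1 footnote (PDF p. 4)] [cite: Edmonds1965, §2 Thm. (P) (p. 126)] -/
theorem image_restrict_pmPolytope :
    (LinearMap.funLeft ℝ ℝ (edgeIncl (halfGraph_le (n := n)))) '' pmPolytope (n + n) =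
      edmondsPolytope (halfGraph n) := by
  classical
  apply Set.Subset.antisymm
  · rintro _ ⟨x, hx, rfl⟩
    rw [pmPolytope_eq_edmondsPolytope_inter] at hx
    exact restrictEdges_mem_edmondsPolytope halfGraph_le hx.1
  · rw [edmondsPolytope_eq_convexHull, pmPolytope, LinearMap.image_convexHull]
    refine convexHull_mono fun y hy => ?_
    obtain ⟨M, hM, hMe⟩ := extend_matching hy
    refine ⟨charVec M, ⟨M, hM, rfl⟩, funext fun e => ?_⟩
    rw [LinearMap.funLeft_apply]
    show (if ((edgeIncl halfGraph_le e : (⊤ : SimpleGraph (Fin (n + n))).edgeSet) :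
        Sym2 (Fin (n + n))) ∈ M then (1 : ℝ) else 0) = y e
    rw [coe_edgeIncl]
    by_cases h : y e = 1
    · rw [if_pos ((hMe e).2 h), h]
    · rw [if_neg (fun hm => h ((hMe e).1 hm))]
      rcases hy.1 e with h0 | h1
      · rw [h0]
      · exact absurd h1 h

end Projection

/-! ### Consequences: `xc(P_M(K_n)) ≤ xc(P_PM(K_{2n}))` and its semidefinite twin -/

/-- **`xc(P_M(K_n)) ≤ xc(P_PM(K_{2n}))`**: an extended formulation of the perfect matching polytope of
`K_{2n}` of size `r` yields one of the matching polytope of `K_n` of size `r` (project onto `E(U)` —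
`HasEFOfSize.image_linearMap` — and identify the copy `H` of `K_n` with `K_n` —
`hasEFOfSize_edmondsPolytope_map_iff`). [cite: Rothvoss2017, §1 (PDF p. 4, L41–42 and footnote)] -/
theorem hasEFOfSize_edmondsPolytope_of_pmPolytope_two_mul {r : ℕ}
    (h : HasEFOfSize (pmPolytope (n + n)) r) :
    HasEFOfSize (edmondsPolytope (⊤ : SimpleGraph (Fin n))) r := by
  classical
  have h1 := h.image_linearMap (LinearMap.funLeft ℝ ℝ (edgeIncl (halfGraph_le (n := n))))
  rw [image_restrict_pmPolytope] at h1
  exact (hasEFOfSize_edmondsPolytope_map_iff (G := (⊤ : SimpleGraph (Fin n)))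
    (Fin.castAddEmb n)).1 h1

/-- **The semidefinite twin: a psd lift of `P_PM(K_{2n})` of size `k` yields one of `P_M(K_n)` of
size `k`** (projections and relabellings are free for psd lifts: `HasPsdLift.image`,
`hasPsdLift_edmondsPolytope_map_iff`). [cite: Rothvoss2017, §1 (PDF p. 4, L41–42 and footnote) and §4.2 (PDF p. 13)] -/
theorem hasPsdLift_edmondsPolytope_of_pmPolytope_two_mul {k : ℕ}
    (h : HasPsdLift (pmPolytope (n + n)) k) :
    HasPsdLift (edmondsPolytope (⊤ : SimpleGraph (Fin n))) k := by
  classical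
  have h1 := h.image (LinearMap.funLeft ℝ ℝ (edgeIncl (halfGraph_le (n := n))))
  rw [image_restrict_pmPolytope] at h1
  exact (hasPsdLift_edmondsPolytope_map_iff (G := (⊤ : SimpleGraph (Fin n)))
    (Fin.castAddEmb n)).1 h1

/-- `xc(P_M(K_n)) ≤ xc(P_PM(K_{2m}))` for `n ≤ m` (compose with the monotonicity of `xc(P_M(K_n))` in `n`,
`hasEFOfSize_edmondsPolytope_top_of_le`). [cite: Rothvoss2017, §1 (PDF p. 4, L41–42 and footnote)] -/
theorem hasEFOfSize_edmondsPolytope_of_pmPolytope_of_le {m r : ℕ} (hnm : n ≤ m)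
    (h : HasEFOfSize (pmPolytope (m + m)) r) :
    HasEFOfSize (edmondsPolytope (⊤ : SimpleGraph (Fin n))) r :=
  hasEFOfSize_edmondsPolytope_top_of_le hnm (hasEFOfSize_edmondsPolytope_of_pmPolytope_two_mul h)

/-- A psd lift of `P_PM(K_{2m})` of size `k` yields one of `P_M(K_n)` for `n ≤ m`.
[cite: Rothvoss2017, §1 (PDF p. 4, L41–42 and footnote) and §4.2 (PDF p. 13)] -/
theorem hasPsdLift_edmondsPolytope_of_pmPolytope_of_le {m k : ℕ} (hnm : n ≤ m)
    (h : HasPsdLift (pmPolytope (m + m)) k) :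
    HasPsdLift (edmondsPolytope (⊤ : SimpleGraph (Fin n))) k :=
  hasPsdLift_edmondsPolytope_top_of_le hnm (hasPsdLift_edmondsPolytope_of_pmPolytope_two_mul h)

/-- **The two families are polynomially equivalent (LP)**: `xc(P_PM(K_n)) ≤ xc(P_M(K_n)) ≤ xc(P_PM(K_{2n}))`,
in the `HasEFOfSize` currency. [cite: Rothvoss2017, §1 (PDF p. 4, L40–42)] -/
theorem hasEFOfSize_matching_sandwich {r : ℕ} :
    (HasEFOfSize (pmPolytope (n + n)) r →
        HasEFOfSize (edmondsPolytope (⊤ : SimpleGraph (Fin n))) r) ∧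
      (HasEFOfSize (edmondsPolytope (⊤ : SimpleGraph (Fin n))) r →
        HasEFOfSize (pmPolytope n) r) :=
  ⟨hasEFOfSize_edmondsPolytope_of_pmPolytope_two_mul, HasEFOfSize.pmPolytope_of_edmondsPolytope⟩

/-- **The two families are polynomially equivalent (SDP)**: a psd lift of `P_PM(K_{2n})` of size `k`
gives one of `P_M(K_n)`, which gives one of `P_PM(K_n)`. [cite: Rothvoss2017, §1 (PDF p. 4, L40–42) and §4.2 (PDF p. 13)] -/
theorem hasPsdLift_matching_sandwich {k : ℕ} :
    (HasPsdLift (pmPolytope (n + n)) k →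
        HasPsdLift (edmondsPolytope (⊤ : SimpleGraph (Fin n))) k) ∧
      (HasPsdLift (edmondsPolytope (⊤ : SimpleGraph (Fin n))) k →
        HasPsdLift (pmPolytope n) k) :=
  ⟨hasPsdLift_edmondsPolytope_of_pmPolytope_two_mul, hasPsdLift_pmPolytope_of_edmondsPolytope⟩

end Literature.Barriers.PneNP

end
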